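import Summits.QuantumFields.YangMills.Theorems.BalabanUVNodesRateReadingOfRecord13
import Summits.QuantumFields.YangMills.Theorems.BalabanUVNodesN22AtW1Reading13CoPH
import Summits.QuantumFields.YangMills.Theorems.BalabanUVNodesRateCarriersOfRecord13CoPHOn
import Literature.MathematicalPhysics.QuantumFieldTheory.Balaban1983to89.Node00.RateRecord11NE3Data

/-!
# v1.7 `CoPH` EDITION (HISTORY-INDEXED RESIDUAL 𝐓-WEIGHTS, FINDING №9) of 6″ — the `CoPR ↦ CoPH` image of this seat's v1.6 module `BalabanUVNodesRateReadingOfRecord13CoPR` (p536371), itself the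
# `CoP ↦ CoPR` image of the v1.5 module (FINDING №8); role and decl list = the ‴ header of record below under T₇ ∘ T₆.
#
# WHY THIS FILE EXISTS (director-ym LINE №183 RULING H1ʰ ∕ №186 (α) ∕ №187 FILING GATES CLEARED, pub-ymgap INBOX l.20100 ∕ l.20321 ∕ l.20335; def-T LOCATED-9
# «HISTORY-BLIND RESIDUAL 𝐓-WEIGHT SLOT»: v1.6's run-indexed slot `Stage13RParams.Zr p` is still NARROWER than print — print's ζ(Ω^c_{k+1}) ([Balaban1988Convergent] p.257
# L31–34, p.267, (3.2)–(3.5), (3.23) p.270) is built from THE TERM's history (Ω, Λ, …); FINDING-№8 class one index further on the same axis).  def-T's FILE 27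
# `Node00/Record13CoPH` (p537939) introduced `structure Stage13HParams extends Stage13RParams` with ONE new HISTORY-INDEXED field `Zh`, the guard `Stage13HParams.ZhUnity`,
# the proviso core `Stage13HParams.Provisos₁₃CoPH` (rows `zhLaws ∕ zhLocal` replacing `zrLaws ∕ zrLocal`), the datum `datumOfRecord₁₃CoPH`, the record class
# `IsRecordOfRecord₁₃CCoPH` and the one-way history-blind door `Stage13HParams.ofHistoryBlind` from v1.6; RR-2 re-keyed the datum key on it (`Node00/Record13DatumKeyCoPH`, p539151:
# `IsDatumOfRecord₁₃CCoPH ∕ CCoPHOn ∕ CCoPHN`, `IsRecordOfRecord₁₃CCoPHOn ∕ CCoPHN`, the guard of record `unityNondeg₁₃H`); plan presses rev 24 (⁷ = T₇(⁶), K3⁷ `SpineGivenEndpointR13SepCoPH`).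
# A theorem binding `θ : Stage13RParams` cannot be applied at a `Stage13HParams` item tuple's datum, so every storey typed `∀ (θ : Stage13RParams F N) (hc :
# θ.Provisos₁₃CoPR F N), …` is re-keyed ONCE MORE; this file is the (T-RATE) pen's image of its own v1.6 module under def-T's KEY-RULE (T₇), token for token:
#   binder `Stage13RParams ↦ Stage13HParams` (readings `lit ∕ ne1`, residual maps `w1 ∕ ℓ₃ ∕ ne2`, regimes `Rg`, selectors `ksel`, tower families are typed over
#   `Stage13HParams`) · `θ.Provisos₁₃CoPR ↦ θ.Provisos₁₃CoPH` · `datumOfRecord₁₃CoPR ↦ datumOfRecord₁₃CoPH` · `(Is|is)(Datum|Record)OfRecord₁₃CCoPR(On|N) ↦ …₁₃CCoPH(On|N)` ·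
#   guard `θ.ZrUnity ↦ θ.ZhUnity`, `Node00.unityNondeg₁₃R ↦ Node00.unityNondeg₁₃H` · THIS seat's stems `…₁₃CoPR… ↦ …₁₃CoPH…` (`RateReading₁₃CoPH`, `rateCarriersOfRecord₁₃CoPH`,
#   `RRec₁₃CoPH(On)`, `rRec₁₃CoPH…`, `readingOfRecord₁₃CoPH`, `…datumKey₁₃CoPH…`, `n22_tupleReadingOfRecordCoPH(On)…`; the unity-regime example face `…_zrUnity_iff ↦ …_zhUnity_iff`)
#   and module names `…13CoPR… ↦ …13CoPH…`.  NO new SITE-RULE: this lineage reads no 𝐓-weight slot; the θ-only ‴ bundle and closers (`u3OfRecord₁₃`, its faces,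
#   `n22At_u3OfRecord₁₃_…`) and RR-2's `RateAssignment₁₃` stay applied at `θ.toStage13Params` exactly as in v1.6 (the parent view resolves through the two `extends`
#   levels; `θ.toStage12Params ∕ θ.γ ∕ θ.L`, `θ.Admissible F N`, `θ.SlotsNondegenerate₁₃ F N` likewise — unchanged text).
# Statements = the v1.6 statements under the map, proofs = the v1.6 proofs verbatim (kernel re-derivations BY NAME); the ‴ ∕ ⁗ ∕ Co ∕ CoP ∕ CoPR editions of this module
# stay in the tree as the aside items' context (nothing landed is edited or re-declared).  bg-BLIND and 𝐓-WEIGHT-BLIND as before — which is why the port is a token map.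
#
# ITEM IDS: crux names ∕ item ids quoted in the ‴ header of record below are those of EARLIER revisions, asides now; this file is filed `--supports stmt-QuantumFields-20509`
# (K3⁶ `SpineGivenEndpointR13SepCoPR`, the K3 item of record AT FILING TIME — KEY-22 STANDS during the rev-24 press, director-ym №190 ∕ dag-lead DEDUP-301 MIS-KEY rule «a file keyed ⁶ stands, never re-filed»; the K3⁷ `SpineGivenEndpointR13SepCoPH` id follows on dag-lead's WORDS-143) as a HELPER — count-neutral, no stub closed, N22 NOT discharged, no inhabitant of any key claimed (K0 OPEN at every edition), nothing of Bałaban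
# asserted; one finite 𝕋⁴ programme at fixed ε — NOT continuum ∕ OS ∕ mass-gap ∕ Clay.
#
# ‴ HEADER OF RECORD FOLLOWS (token-mapped; its decl lists are this file's, the θ-only names above excepted):
#
# THE RATE READING OF RECORD AT STAGE 13, EDITION 1 — `YMDAG.UVSplit.readingOfRecord₁₃CoPH w1 ℓ₃ ne2 ne1 : RateReading₁₃CoPH N`: the (T-RATE) home's Stage-13 reading with the
# TWO components the definers have PINNED BY NAME plugged in — node U3's objects := node00-def-W1's W1 reading data `(w1 F θ).u3Objects θ.γ` read per Stage-13 tuple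
# (`Node00/RateRecordW1Reading` §3, p465810; `w1 : (F : T4Family) → (θ : Stage13HParams F N) → W1.ReadingData F (M_N ℂ) θ.τ9.M`) and N16's NE3 layer := node00-def-RR-1's
# CONSTANT READING OF RECORD `ne3ConstReadingOfRecord₁₁ F N (ℓ₃ F)` (`Node00/RateRecord11NE3Data`, p467746) — the other two (N15's `ne2`, NODE O's dressed tower `ne1`)
# RESIDUAL parameters typed over `Stage13HParams`; and what the K4 stubs at `RRec₁₃CoPH (readingOfRecord₁₃CoPH …)` ∕ `RRec₁₃CoPHOn (readingOfRecord₁₃CoPH …) Rg` SAY, by name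

Track A of `YM-PLAN.md` (cell `pub-ymgap`, HUMAN RULING D-0062), R134 seat `pub-ymgap-dag-n22-e` ((T-RATE) pen), gen 5, module 6″ = the Stage-13 edition of the lineage's
module 6 `…RateReadingOfRecord12.lean` (p469629; director-ym LINE №125 «RECORD 13» ∕ №133, route rev 16 ∕ 17, K3‴ `SpineGivenEndpointR13` = stmt-QuantumFields-19912;
dag-lead WORDS-133 ∕ 134 ∕ 135).  WHY.  «A skeleton quoting `S_N1x (RRec₁₃CoPH 𝔯)` NAMES its `𝔯`» (layer B's binding framing): this module NAMES the Stage-13 reading of record as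
far as the tree's definers have pinned it — DIRECTLY over the Stage-13-typed residual maps (no Stage-12 lift `RateAssignment₁₃.ofStage12 (W1.assignment₁₂ 𝔇)`, which would
read the W1 data off `θ.toStage12Params` only; no new W1 container is minted — W1's STAGE-FREE `ReadingData` is consumed by name), so that the `hpin`-generic N22 ∕ N16 faces
at ₁₃ (`…N22AtW1Reading13`, dag-n16-e's `…N16AtTupleReading13` ∕ pre-staged `…N16AtRRec13`) instantiate here with `hpin := rfl`.  Definition lane (ONE `def`); every theorem
is kernel bookkeeping; 0 `sorry`; COUNT-NEUTRAL; `--supports` K3‴ as a helper.  Restate-immune (no Theses import); nothing landed is edited.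

WHAT THIS MODULE PROVES ([bookkeeping]).
* §1 `readingOfRecord₁₃CoPH w1 ℓ₃ ne2 ne1` · component faces `readingOfRecord₁₃CoPH_u3 ∕ _ne3 ∕ _ne2 ∕ _ne1` (`rfl`) · `readingOfRecord₁₃CoPH_populated_iff` (the reading's objects are
  POPULATED iff N15's residual layer is — W1's U3 layer and RR-1's constant layer are populated unconditionally).
* §2 WHAT THE STUBS SAY AT `RRec₁₃CoPH (readingOfRecord₁₃CoPH …)`: `s_N16_readingOfRecord₁₃CoPH_iff` (N16 = `N16At (ne3OfRecord₁₁ F (ne3ConstLayerOfRecord₁₁ F N (ℓ₃ F)))` at every family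
  carrying a Stage-13 datum of record — ONE sentence per family) · `n16At_of_s_N16_readingOfRecord₁₃CoPH` · `s_N22_readingOfRecord₁₃CoPH_iff` ∕ `_iff_ne9` (N22 = the
  history-Lipschitz inequality for W1's `Re E(S k)(X; ·; embA U)` per key and run length — module 9″c with `hpin := rfl`) · `s_N22_readingOfRecord₁₃CoPH_of_oscAnalytic` (ROAD 3) ·
  `s_N22_readingOfRecord₁₃CoPH_of_ne9_fading` · `s_N18_readingOfRecord₁₃CoPH_iff` · `s_N15 ∕ s_N14_readingOfRecord₁₃CoPH_iff` · `s_N17 ∕ s_D4_readingOfRecord₁₃CoPH_iff` (on the datum).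
* §3 THE GUARDED θ-FORMS at the regime home `RRec₁₃CoPHOn (readingOfRecord₁₃CoPH …) Rg` (what a rev-16 composer with the guard inside reads): `s_N22_readingOfRecord₁₃CoPHOn_iff` ·
  `s_N16_readingOfRecord₁₃CoPHOn_iff` · `s_N18_readingOfRecord₁₃CoPHOn_iff`.
* §4 HONESTY: `s_N22_readingOfRecord₁₃CoPH_of_EA_zero` (vanishing W1 towers close N22's stub at the reading of record: the towers are DATA, not yet the construction's (2.14) terms).

HONEST FRAMING.  Two pins CONSUMED BY NAME (W1's stage-free reading-data container — whose towers are residual data —, RR-1's constant NE3 reading — a pin CONVENTION with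
parametric letters); two components residual; every node estimate (NE1′, NE2, NE3, NE4, NE5, NE9) is a DISPLAYED hypothesis with no producer at this reading today; nothing of
Bałaban's is asserted or instantiated; NE1′–NE9 are NOT PRINTED for d = 4 and NOT PROVED; no inhabitant of `IsDatumOfRecord₁₃CCoPH` claimed (K0‴ `Record13Inhabited`,
stmt-QuantumFields-19909, OPEN); no node discharged; counts UNMOVED (typed 28∕28 · discharged 5∕27, A 5∕28); one finite four-torus programme at fixed `ε` — NOT ℝ⁴, NOT
infinite volume, NOT OS, NOT a mass gap, NOT Clay.  No decl below carries a cite tag.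
-/

noncomputable section

namespace YMDAG.UVSplit

open Set Metric
open scoped BigOperators
open Literature.MathematicalPhysics.QuantumFieldTheory.Balaban1983to89
open Literature.MathematicalPhysics.QuantumFieldTheory.Balaban1983to89.T4Continuum
open Literature.MathematicalPhysics.QuantumFieldTheory.Balaban1983to89.T4OutputRate
open Literature.MathematicalPhysics.QuantumFieldTheory.Balaban1983to89.Node00 (Stage13HParams datumOfRecord₁₃CoPH IsDatumOfRecord₁₃CCoPH NE3Letters₁₁ NE2Objects₁₁
  ne3ConstLayerOfRecord₁₁ ne3ConstReadingOfRecord₁₁ MatA)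
open Literature.MathematicalPhysics.QuantumFieldTheory.Balaban1983to89.Node00.Sect2 (domSys)
open Literature.MathematicalPhysics.QuantumFieldTheory.Balaban1983to89.Node00.W1 (ReadingData functionalC)

variable {N : ℕ} [NeZero N]

/-! ## §1 The Stage-13 reading of record, edition 1, and its component faces -/

/-- **THE RATE READING OF RECORD AT STAGE 13, EDITION 1**: node U3's objects := W1's reading data at window radius `θ.γ`; N16's layer := RR-1's constant reading of record with
letters `ℓ₃ F`; N15's layer `ne2` and NODE O's dressed tower `ne1` residual — all read PER STAGE-13 TUPLE (the provisos are not read). -/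
def readingOfRecord₁₃CoPH (w1 : (F : T4Family) → (θ : Stage13HParams F N) → ReadingData F (MatA N) θ.τ9.M) (ℓ₃ : T4Family → NE3Letters₁₁)
    (ne2 : (F : T4Family) → Stage13HParams F N → (ℕ → ℝ) → List (ULoop F) → ℕ → NE2Objects₁₁)
    (ne1 : (F : T4Family) → Stage13HParams F N → (ℕ → ℝ) → List (ULoop F) → NE1pCarriers) : RateReading₁₃CoPH N :=
  ⟨fun F θ _ g₀ os => ⟨(w1 F θ).u3Objects θ.γ, ne3ConstReadingOfRecord₁₁ F N (ℓ₃ F), ne2 F θ g₀ os⟩, fun F θ _ g₀ os => ne1 F θ g₀ os⟩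

section Faces

variable (w1 : (F : T4Family) → (θ : Stage13HParams F N) → ReadingData F (MatA N) θ.τ9.M) (ℓ₃ : T4Family → NE3Letters₁₁)
  (ne2 : (F : T4Family) → Stage13HParams F N → (ℕ → ℝ) → List (ULoop F) → ℕ → NE2Objects₁₁)
  (ne1 : (F : T4Family) → Stage13HParams F N → (ℕ → ℝ) → List (ULoop F) → NE1pCarriers)

/-- Face: node U3's objects of the reading of record ARE W1's at window radius `θ.γ` (`rfl`) — module 9″c's `hpin`. -/
theorem readingOfRecord₁₃CoPH_u3 (F : T4Family) (θ : Stage13HParams F N) (hP : θ.Provisos₁₃CoPH F N) (g₀ : ℕ → ℝ) (os : List (ULoop F)) :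
    ((readingOfRecord₁₃CoPH w1 ℓ₃ ne2 ne1).lit F θ hP g₀ os).u3 = (w1 F θ).u3Objects θ.γ := rfl

/-- Face: N16's layer of the reading of record IS RR-1's constant layer of record at EVERY run length (`rfl`) — dag-n16-e's `hpin` ∕ `hconst`. -/
theorem readingOfRecord₁₃CoPH_ne3 (F : T4Family) (θ : Stage13HParams F N) (hP : θ.Provisos₁₃CoPH F N) (g₀ : ℕ → ℝ) (os : List (ULoop F)) (k : ℕ) :
    ((readingOfRecord₁₃CoPH w1 ℓ₃ ne2 ne1).lit F θ hP g₀ os).ne3 k = ne3ConstLayerOfRecord₁₁ F N (ℓ₃ F) := rfl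

/-- Face: N16's component IS RR-1's object of record `ne3OfRecord₁₁ F (ne3ConstLayerOfRecord₁₁ F N (ℓ₃ F))` (`rfl`; the `hpin` of `…N16AtTupleReading13` at the level-selected
tuple reading of this home). -/
theorem readingOfRecord₁₃CoPH_ne3OfRecord (F : T4Family) (θ : Stage13HParams F N) (hP : θ.Provisos₁₃CoPH F N) (g₀ : ℕ → ℝ) (os : List (ULoop F)) (k : ℕ) :
    (rateCarriersOfRecord₁₃CoPH (readingOfRecord₁₃CoPH w1 ℓ₃ ne2 ne1) F θ hP g₀ os k).ne3 = ne3OfRecord₁₁ F (ne3ConstLayerOfRecord₁₁ F N (ℓ₃ F)) := rfl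

/-- Face: N15's layer is the residual one (`rfl`). -/
theorem readingOfRecord₁₃CoPH_ne2 (F : T4Family) (θ : Stage13HParams F N) (hP : θ.Provisos₁₃CoPH F N) (g₀ : ℕ → ℝ) (os : List (ULoop F)) (k : ℕ) :
    ((readingOfRecord₁₃CoPH w1 ℓ₃ ne2 ne1).lit F θ hP g₀ os).ne2 k = ne2 F θ g₀ os k := rfl

/-- Face: N14's dressed tower is the residual one (`rfl`). -/
theorem readingOfRecord₁₃CoPH_ne1 (F : T4Family) (θ : Stage13HParams F N) (hP : θ.Provisos₁₃CoPH F N) (g₀ : ℕ → ℝ) (os : List (ULoop F)) :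
    (readingOfRecord₁₃CoPH w1 ℓ₃ ne2 ne1).ne1 F θ hP g₀ os = ne1 F θ g₀ os := rfl

/-- Face: the U3 component of the run-length-`k` bundle IS `u3OfRecord₁₃ θ.toStage13Params ((w1 F θ).u3Objects θ.γ) k` (`rfl`). -/
theorem readingOfRecord₁₃CoPH_bundle_u3 (F : T4Family) (θ : Stage13HParams F N) (hP : θ.Provisos₁₃CoPH F N) (g₀ : ℕ → ℝ) (os : List (ULoop F)) (k : ℕ) :
    (rateCarriersOfRecord₁₃CoPH (readingOfRecord₁₃CoPH w1 ℓ₃ ne2 ne1) F θ hP g₀ os k).u3 = u3OfRecord₁₃ θ.toStage13Params ((w1 F θ).u3Objects θ.γ) k := rfl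

/-- **THE READING OF RECORD IS POPULATED IFF N15's RESIDUAL LAYER IS** — W1's U3 layer (`ReadingData.u3Objects_populated`) and RR-1's constant NE3 layer
(`populated_ne3ConstLayerOfRecord₁₁`) are populated UNCONDITIONALLY. -/
theorem readingOfRecord₁₃CoPH_populated_iff (F : T4Family) (θ : Stage13HParams F N) (hP : θ.Provisos₁₃CoPH F N) (g₀ : ℕ → ℝ) (os : List (ULoop F)) :
    ((readingOfRecord₁₃CoPH w1 ℓ₃ ne2 ne1).lit F θ hP g₀ os).Populated ↔ ∀ k, (ne2 F θ g₀ os k).Populated :=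
  ⟨fun h => h.2.2, fun h => ⟨(w1 F θ).u3Objects_populated θ.γ, fun _ => Node00.populated_ne3ConstLayerOfRecord₁₁ F N (ℓ₃ F), h⟩⟩

/-! ## §2 What the K4 stubs say at `RRec₁₃CoPH (readingOfRecord₁₃CoPH w1 ℓ₃ ne2 ne1)` -/

/-- **N16 AT THE READING OF RECORD**: `S_N16` IS «`N16At (ne3OfRecord₁₁ F (ne3ConstLayerOfRecord₁₁ F N (ℓ₃ F)))` for every family carrying a Stage-13 datum of record» — ONE
sentence per family about RR-1's NAMED unit-lattice data (layer B's `s_N16_rRec₁₃CoPH_iff`, the constant layer by `rfl`). -/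
theorem s_N16_readingOfRecord₁₃CoPH_iff :
    S_N16 (RRec₁₃CoPH (readingOfRecord₁₃CoPH w1 ℓ₃ ne2 ne1)) ↔
      ∀ (F : T4Family), (∃ D : Datum F N, IsDatumOfRecord₁₃CCoPH F N D) → N16At (ne3OfRecord₁₁ F (ne3ConstLayerOfRecord₁₁ F N (ℓ₃ F))) := by
  rw [s_N16_rRec₁₃CoPH_iff]
  exact ⟨fun H F ⟨D, h⟩ => H F D h (fun _ => 0) [] 0, fun H F D h _ _ _ => H F ⟨D, h⟩⟩

/-- … so under `S_N16` at the reading of record, `N16At` holds at RR-1's layer of every family with a datum of record (n21-d's `h16` binder, named). -/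
theorem n16At_of_s_N16_readingOfRecord₁₃CoPH (hS : S_N16 (RRec₁₃CoPH (readingOfRecord₁₃CoPH w1 ℓ₃ ne2 ne1))) (F : T4Family) {D : Datum F N}
    (hD : IsDatumOfRecord₁₃CCoPH F N D) : N16At (ne3OfRecord₁₁ F (ne3ConstLayerOfRecord₁₁ F N (ℓ₃ F))) :=
  (s_N16_readingOfRecord₁₃CoPH_iff w1 ℓ₃ ne2 ne1).mp hS F ⟨D, hD⟩

/-- **N22 AT THE READING OF RECORD**: `S_N22` IS «`N22At` at every Stage-13 datum key and run length of W1's objects at the canonical parameter» (module 9″c; `ne1 ∕ ne2 ∕ ne3`,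
`g₀`, `os` idle). -/
theorem s_N22_readingOfRecord₁₃CoPH_iff :
    S_N22 (RRec₁₃CoPH (readingOfRecord₁₃CoPH w1 ℓ₃ ne2 ne1)) ↔
      ∀ (F : T4Family) (D : Datum F N) (h : IsDatumOfRecord₁₃CCoPH F N D) (k : ℕ), N22At (u3OfRecord₁₃ h.params.toStage13Params ((w1 F h.params).u3Objects h.params.γ) k) :=
  YMDAG.N22.s_N22_rRec₁₃CoPH_w1_iff _ w1 fun _ _ _ _ _ => rfl

/-- **… IN PRINT-LIKE FORM** (under the analytic blocks' signs at the canonical parameters): the history-Lipschitz inequality for `Re E((w1 F θ).S k)(X; ·; embA U)` on `]0, θ.γ]`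
per key and run length (module 9″c's `s_N22_rRec₁₃CoPH_w1_iff_ne9`). -/
theorem s_N22_readingOfRecord₁₃CoPH_iff_ne9
    (hs : ∀ (F : T4Family) (D : Datum F N) (h : IsDatumOfRecord₁₃CCoPH F N D), ((w1 F h.params).li.analytic h.params.γ).Signs) :
    S_N22 (RRec₁₃CoPH (readingOfRecord₁₃CoPH w1 ℓ₃ ne2 ne1)) ↔
      ∀ (F : T4Family) (D : Datum F N) (h : IsDatumOfRecord₁₃CCoPH F N D) (k : ℕ),
        ∀ g ∈ Window h.params.γ, ∀ g' ∈ Window h.params.γ,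
          ∀ (U : ((w1 F h.params).pairing k).BgA) (X : Node00.W1.Dom (F.P k) h.params.τ9.M),
            |(functionalC ((w1 F h.params).S k) g (((w1 F h.params).pairing k).embA U) X).re -
                (functionalC ((w1 F h.params).S k) g' (((w1 F h.params).pairing k).embA U) X).re| ≤
              Real.exp (-(((w1 F h.params).li.analytic h.params.γ).κ * (domSys (F.P k) h.params.τ9.M X.1).dj X.2)) *
                ∑ i ∈ Finset.range X.1, ((w1 F h.params).li.analytic h.params.γ).moduli X.1 i * |g i - g' i| :=
  YMDAG.N22.s_N22_rRec₁₃CoPH_w1_iff_ne9 _ w1 (fun _ _ _ _ _ => rfl) hs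

/-- **ROAD 3 AT THE READING OF RECORD** (module 9″c's `s_N22_rRec₁₃CoPH_w1_of_oscAnalytic` with `hpin := rfl`). -/
theorem s_N22_readingOfRecord₁₃CoPH_of_oscAnalytic
    (hnum : ∀ (F : T4Family) (θ : Stage13HParams F N), θ.Provisos₁₃CoPH F N → θ.Admissible F N →
      0 < (w1 F θ).li.C₀ ∧ 0 < (w1 F θ).li.θ₅ ∧ 0 < (w1 F θ).li.A ∧ (w1 F θ).li.θ₅ ≤ (w1 F θ).li.μ ∧
        (w1 F θ).li.C₀ ≤ 2 * (w1 F θ).li.A ∧ 0 < (w1 F θ).li.r ∧ 0 < (w1 F θ).li.s ∧ (w1 F θ).li.s < 1)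
    (hO : ∀ (F : T4Family) (θ : Stage13HParams F N), θ.Provisos₁₃CoPH F N → θ.Admissible F N → ∀ (k : ℕ),
      ∀ g ∈ Window θ.γ, ∀ g' ∈ Window θ.γ, ∀ (U : (((w1 F θ).u3Objects θ.γ).levelCarriers k).BgA)
        (X : (((w1 F θ).u3Objects θ.γ).levelCarriers k).Dom) (a : ℕ), a ≤ (((w1 F θ).u3Objects θ.γ).levelCarriers k).scale X →
        (∀ n, a ≤ n → g n = g' n) →
          |((w1 F θ).u3Objects θ.γ).EA k g U X - ((w1 F θ).u3Objects θ.γ).EA k g' U X| ≤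
            (w1 F θ).li.C₀ * ((w1 F θ).u3Objects θ.γ).θ₅ ^ ((((w1 F θ).u3Objects θ.γ).levelCarriers k).scale X - a) *
              Real.exp (-(((w1 F θ).u3Objects θ.γ).κ * (((w1 F θ).u3Objects θ.γ).levelCarriers k).d X)))
    (hA : ∀ (F : T4Family) (θ : Stage13HParams F N), θ.Provisos₁₃CoPH F N → θ.Admissible F N → ∀ (k : ℕ),
      ∀ g ∈ Window θ.γ, ∀ (U : (((w1 F θ).u3Objects θ.γ).levelCarriers k).BgA) (X : (((w1 F θ).u3Objects θ.γ).levelCarriers k).Dom) (i : ℕ),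
        i < (((w1 F θ).u3Objects θ.γ).levelCarriers k).scale X → ∃ (Fz : ℂ → ℂ) (Dset : Set ℂ), DifferentiableOn ℂ Fz Dset ∧
          (∀ z ∈ Dset, ‖Fz z‖ ≤ (w1 F θ).li.A * (w1 F θ).li.μ ^ ((((w1 F θ).u3Objects θ.γ).levelCarriers k).scale X - 1 - i) *
            Real.exp (-(((w1 F θ).u3Objects θ.γ).κ * (((w1 F θ).u3Objects θ.γ).levelCarriers k).d X))) ∧
          (∀ t ∈ Ioc (0 : ℝ) θ.γ, closedBall (t : ℂ) (w1 F θ).li.r ⊆ Dset) ∧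
          (∀ t ∈ Ioc (0 : ℝ) θ.γ, Fz t = (((w1 F θ).u3Objects θ.γ).EA k (Function.update g i t) U X : ℂ))) :
    S_N22 (RRec₁₃CoPH (readingOfRecord₁₃CoPH w1 ℓ₃ ne2 ne1)) :=
  YMDAG.N22.s_N22_rRec₁₃CoPH_w1_of_oscAnalytic _ w1 (fun _ _ _ _ _ => rfl) hnum hO hA

/-- **THE SLOT-FREE ROAD AT THE READING OF RECORD** («`FadingMemory` by name from a modulus»; module 9″c's `s_N22_rRec₁₃CoPH_w1_of_ne9_fading` with `hpin := rfl`). -/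
theorem s_N22_readingOfRecord₁₃CoPH_of_ne9_fading
    (h9 : ∀ (F : T4Family) (θ : Stage13HParams F N), θ.Provisos₁₃CoPH F N → θ.Admissible F N → ∀ (k : ℕ),
      ((w1 F θ).li.analytic θ.γ).Signs ∧ ∃ (Λ : ℕ → ℕ → ℝ) (C₉ : ℝ),
        NE9 (((w1 F θ).u3Objects θ.γ).EA k) (Window θ.γ) (w1 F θ).li.κ Λ ∧
          FadingMemory C₉ ((w1 F θ).li.analytic θ.γ).ω Λ ∧ C₉ ≤ ((w1 F θ).li.analytic θ.γ).C₉) :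
    S_N22 (RRec₁₃CoPH (readingOfRecord₁₃CoPH w1 ℓ₃ ne2 ne1)) :=
  YMDAG.N22.s_N22_rRec₁₃CoPH_w1_of_ne9_fading _ w1 (fun _ _ _ _ _ => rfl) h9

/-- **N18 AT THE READING OF RECORD**: `S_N18` IS «NE5 at every Stage-13 datum key, run length `k` and member `b ∈ ]0, θ.γ]` of W1's level-`k` pairing» (`g₀`, `os` idle;
layer B's `s_N18_rRec₁₃CoPH_iff`; W1's `ne5_u3Objects_iff` unfolds it to the printed-shape inequality). -/
theorem s_N18_readingOfRecord₁₃CoPH_iff :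
    S_N18 (RRec₁₃CoPH (readingOfRecord₁₃CoPH w1 ℓ₃ ne2 ne1)) ↔
      ∀ (F : T4Family) (D : Datum F N) (h : IsDatumOfRecord₁₃CCoPH F N D) (k : ℕ), N18At (u3OfRecord₁₃ h.params.toStage13Params ((w1 F h.params).u3Objects h.params.γ) k) := by
  rw [s_N18_rRec₁₃CoPH_iff]
  exact ⟨fun H F D h k => H F D h (fun _ => 0) [] k, fun H F D h _ _ k => H F D h k⟩

/-- **N15 AT THE READING OF RECORD** — the residual component, read at the canonical parameter (layer B's face, component `rfl`). -/
theorem s_N15_readingOfRecord₁₃CoPH_iff :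
    S_N15 (RRec₁₃CoPH (readingOfRecord₁₃CoPH w1 ℓ₃ ne2 ne1)) ↔
      ∀ (F : T4Family) (D : Datum F N) (h : IsDatumOfRecord₁₃CCoPH F N D) (g₀ : ℕ → ℝ) (os : List (ULoop F)) (k : ℕ),
        N15At (ne2OfRecord₁₁ (ne2 F h.params g₀ os k)) :=
  s_N15_rRec₁₃CoPH_iff _

/-- **N14 AT THE READING OF RECORD** — the residual dressed tower, read at the canonical parameter. -/
theorem s_N14_readingOfRecord₁₃CoPH_iff :
    S_N14 (RRec₁₃CoPH (readingOfRecord₁₃CoPH w1 ℓ₃ ne2 ne1)) ↔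
      ∀ (F : T4Family) (D : Datum F N) (h : IsDatumOfRecord₁₃CCoPH F N D) (g₀ : ℕ → ℝ) (os : List (ULoop F)), N14At (ne1 F h.params g₀ os) :=
  s_N14_rRec₁₃CoPH_iff _

/-- **N17 AT THE READING OF RECORD** — NE4 on the datum at the dependent letters of W1's analytic block (`g₀`, `os` idle). -/
theorem s_N17_readingOfRecord₁₃CoPH_iff :
    S_N17 (RRec₁₃CoPH (readingOfRecord₁₃CoPH w1 ℓ₃ ne2 ne1)) ↔
      ∀ (F : T4Family) (D : Datum F N) (h : IsDatumOfRecord₁₃CCoPH F N D) (k : ℕ), N17At D (u3OfRecord₁₃ h.params.toStage13Params ((w1 F h.params).u3Objects h.params.γ) k) := by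
  rw [s_N17_rRec₁₃CoPH_iff]
  exact ⟨fun H F D h k => H F D h (fun _ => 0) [] k, fun H F D h _ _ k => H F D h k⟩

/-- **(D4) AT THE READING OF RECORD** — the β-read-out binders on the datum at W1's bundles (`g₀`, `os` idle). -/
theorem s_D4_readingOfRecord₁₃CoPH_iff :
    S_D4 (RRec₁₃CoPH (readingOfRecord₁₃CoPH w1 ℓ₃ ne2 ne1)) ↔
      ∀ (F : T4Family) (D : Datum F N) (h : IsDatumOfRecord₁₃CCoPH F N D) (k : ℕ), ReadOutAt D (u3OfRecord₁₃ h.params.toStage13Params ((w1 F h.params).u3Objects h.params.γ) k) := by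
  rw [s_D4_rRec₁₃CoPH_iff]
  exact ⟨fun H F D h k => H F D h (fun _ => 0) [] k, fun H F D h _ _ k => H F D h k⟩

/-! ## §3 The guarded θ-forms at the regime home `RRec₁₃CoPHOn (readingOfRecord₁₃CoPH …) Rg` -/

/-- **N22 AT THE REGIME-RESTRICTED READING OF RECORD** (guarded θ-form; `Rg := Node00.unityNondeg₁₃H N` is rev 16's ∕ rev 22's ∕ rev 24's binder prefix): `S_N22 (RRec₁₃CoPHOn (readingOfRecord₁₃CoPH …) Rg)` IS
«for every family, every Stage-13 tuple with provisos in `Rg`, admissible, and every run length `k`: `N22At (u3OfRecord₁₃ θ.toStage13Params ((w1 F θ).u3Objects θ.γ) k)`» (`g₀`, `os` idle). -/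
theorem s_N22_readingOfRecord₁₃CoPHOn_iff (Rg : (F : T4Family) → Stage13HParams F N → Prop) :
    S_N22 (RRec₁₃CoPHOn (readingOfRecord₁₃CoPH w1 ℓ₃ ne2 ne1) Rg) ↔
      ∀ (F : T4Family) (θ : Stage13HParams F N), θ.Provisos₁₃CoPH F N → Rg F θ → θ.Admissible F N → ∀ k : ℕ, N22At (u3OfRecord₁₃ θ.toStage13Params ((w1 F θ).u3Objects θ.γ) k) := by
  rw [s_N22_rRec₁₃CoPHOn_iff]
  exact ⟨fun H F θ hP hRg hθ k => H F θ hP hRg hθ (fun _ => 0) [] k, fun H F θ hP hRg hθ _ _ k => H F θ hP hRg hθ k⟩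

/-- **N16 AT THE REGIME-RESTRICTED READING OF RECORD** (guarded θ-form): `S_N16` there IS «`N16At` at RR-1's layer of every family carrying an admissible Stage-13 tuple with
provisos in `Rg`». -/
theorem s_N16_readingOfRecord₁₃CoPHOn_iff (Rg : (F : T4Family) → Stage13HParams F N → Prop) :
    S_N16 (RRec₁₃CoPHOn (readingOfRecord₁₃CoPH w1 ℓ₃ ne2 ne1) Rg) ↔
      ∀ (F : T4Family), (∃ θ : Stage13HParams F N, θ.Provisos₁₃CoPH F N ∧ Rg F θ ∧ θ.Admissible F N) →
        N16At (ne3OfRecord₁₁ F (ne3ConstLayerOfRecord₁₁ F N (ℓ₃ F))) := by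
  rw [s_N16_rRec₁₃CoPHOn_iff]
  exact ⟨fun H F ⟨θ, hP, hRg, hθ⟩ => H F θ hP hRg hθ (fun _ => 0) [] 0, fun H F θ hP hRg hθ _ _ _ => H F ⟨θ, hP, hRg, hθ⟩⟩

/-- **N18 AT THE REGIME-RESTRICTED READING OF RECORD** (guarded θ-form). -/
theorem s_N18_readingOfRecord₁₃CoPHOn_iff (Rg : (F : T4Family) → Stage13HParams F N → Prop) :
    S_N18 (RRec₁₃CoPHOn (readingOfRecord₁₃CoPH w1 ℓ₃ ne2 ne1) Rg) ↔
      ∀ (F : T4Family) (θ : Stage13HParams F N), θ.Provisos₁₃CoPH F N → Rg F θ → θ.Admissible F N → ∀ k : ℕ, N18At (u3OfRecord₁₃ θ.toStage13Params ((w1 F θ).u3Objects θ.γ) k) := by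
  rw [s_N18_rRec₁₃CoPHOn_iff]
  exact ⟨fun H F θ hP hRg hθ k => H F θ hP hRg hθ (fun _ => 0) [] k, fun H F θ hP hRg hθ _ _ k => H F θ hP hRg hθ k⟩

/-! ## §4 Honesty at the reading of record -/

/-- **VANISHING W1 TOWERS CLOSE N22's STUB AT THE READING OF RECORD** (module 9″c's rider here): the towers inside `w1` are residual DATA; a discharge of
`S_N22 (RRec₁₃CoPH (readingOfRecord₁₃CoPH w1 …))` owes the identification of `(w1 F θ).S k` with the construction's (2.14) terms. -/
theorem s_N22_readingOfRecord₁₃CoPH_of_EA_zero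
    (hs : ∀ (F : T4Family) (θ : Stage13HParams F N), θ.Provisos₁₃CoPH F N → θ.Admissible F N → ((w1 F θ).li.analytic θ.γ).Signs)
    (h0 : ∀ (F : T4Family) (θ : Stage13HParams F N), θ.Provisos₁₃CoPH F N → θ.Admissible F N → ∀ (k : ℕ) (g : ℕ → ℝ)
      (U : (((w1 F θ).u3Objects θ.γ).levelCarriers k).BgA) (X : (((w1 F θ).u3Objects θ.γ).levelCarriers k).Dom), ((w1 F θ).u3Objects θ.γ).EA k g U X = 0) :
    S_N22 (RRec₁₃CoPH (readingOfRecord₁₃CoPH w1 ℓ₃ ne2 ne1)) :=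
  YMDAG.N22.s_N22_rRec₁₃CoPH_w1_of_EA_zero _ w1 (fun _ _ _ _ _ => rfl) hs h0

end Faces

end YMDAG.UVSplit

end
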